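import Summits.FinalStateConjecture.FinalStateConjecture.Theorems.ZeroEnergyKerrOrBombSymplecticDualOfTheBombSig4
import Summits.FinalStateConjecture.FinalStateConjecture.Theorems.ZeroEnergyKerrOrBombStationaryLimitReductionMoncriefFactsAudit
import HarnessLib

/-!
# Route ZeroEnergyKerrOrBomb · crux `StationaryLimitReduction` (stmt-FinalStateConjecture-10021), line
# `symplectic-dual-of-the-bomb` — stub `stub_dualModeEjection` (reshape r4/r5): junk audit of the r4 text and the
# TYPED RESIDUALS (dual-mode transport / bomb saddle / fate) with the kernel-checked decomposition

Helper file (`--supports stmt-FinalStateConjecture-10021`) of the lead's wave-3 stub worker for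
`stub_dualModeEjection : Sig4.stub_dualModeEjection` (statement module `…SymplecticDualOfTheBombSig4.lean`, p123321;
lead prover-line-stmt-FinalStateConjecture-10021-a2-0, 2026-08-16). The registered statement is open as mathematics
(no MGHD is constructible in this tree; the fate of the explosion is an open problem). This file records what IS
decidable and types the decomposition the lead asked for.

## §1 Junk / vacuity audit of the r4 text (first audit; kernel certificates where one exists)

* (i) the steering clause cannot be voided by detectors vanishing near `x₀`: a pair which is zero on a neighbourhood
  of `x₀` IS a local slice tangent at `x₀` (`isLocalSliceTangentAt_of_eventuallyEq_zero`, the constant deformation;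
  generalises `isLocalSliceTangentAt_zero`, p115964), so it is excluded by the non-gauge clause
  (`not_areDetectorsAt_of_eventuallyEq_zero`); far-away junk in the detectors is invisible — the symplectic density
  vanishes where the kick vanishes (`omegaDensity_eq_zero_of_kick_eq_zero`), so the chart pairing reads the detectors
  only on the support of the kick (`chartPairing_congr_on_kick_support`). For honest symmetric detectors at a
  germ-KID-free point transversal admissible families exist (corrected Moncrief transversality, stub 4 — neither
  used nor restated here), so the clause is not vacuous.
* (ii) `k = 0` stays excluded (`not_injOn_ball_of_forall_mem_range_fin0`, p104819); in the decomposition below it is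
  excluded STRUCTURALLY: the zero tangent is a recaptured tangent (`isRecapturedTangentAt_zero`), so the
  transversality hypothesis of the saddle fails for `k = 0` (`not_saddleTransversal_fin_zero`).
* (iii) hypotheses side: the only constructible `StationaryAFBlackHole` of the tree is Kerr
  (`Kerr.stationaryAFBlackHole`), for which `InTelescope` is not certifiable (no global hyperbolicity /
  non-degenerate horizon theorem for the Kerr carrier) and a growing gravitational mode pair is false on paper; no
  MGHD of any admissible datum is constructible: no constructible instance, no cheap refutation — unchanged.
* (iv) the new r4 clauses (`O = exteriorOf 𝒟 d.charted` with collar charts, `HasExhaustiveDocCharts'` with source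
  `O ∩ I⁻(docCharted d)` and overlap margin, `IsHorizonNormalised`) re-read against the abstract causal lemmas
  (`reach_of_hasExhaustiveDocCharts`, `lateRegion_image_subset_chronologicalPast_docCharted`): the only points FORCED
  into `O ∩ I⁻(docCharted d)` are late d.o.c.-part chart points and radiation-zone points, for which reaching
  arbitrarily late d.o.c.-certified slabs is honest (Kerr: a timelike combination of `∂_{t*}`, `∂_φ` at fixed
  `r > r₊`); collar points are in `O` but not forced into `I⁻(docCharted d)`; `diff_subset_causalPast` only constrains
  uncharted points. NO cheap inconsistency for `N ≥ 1`: the currency `SettlesDocWith'` survives this audit.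

## §2–§4 The typed residuals and the decomposition (reshape material)

Two DATA-LEVEL interfaces over the landed vocabulary: `IsRecapturedBy X D' 𝓑` (some MGHD of `D'` settles regularly,
r4 clauses, onto a configuration one of whose holes IS `𝓑`) and `IsRecapturedTangentAt x₀ D 𝓑 a b` (`(a, b)` is the
tangent of an admissible compactly supported curve through `D` recaptured by `𝓑` near `0`); `IsGravitationalBomb d j`
(hole `j` of `d` carries a growing gravitational mode pair). The residuals: `DualModeTransport 𝒟 d x₀ A B` (symmetric
detectors at the germ-KID-free `x₀`, globally smooth, and per gravitational bomb `j` of `d` a selected detector whose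
pairing functional — extended by linearity to combinations of tangents of admissible compactly supported families —
ANNIHILATES every recaptured-by-`𝓑ⱼ` tangent: the Σ₀-data of the backward dual modes kill the tangent space of the
centre-stable manifold); `BombSaddle 𝒟 d x₀` (a family which, for every gravitational bomb of `d`, has SOME tangent
combination that is not recaptured contains a locally injective curve none of whose small non-zero members is
recaptured by any gravitational bomb of `d` — isolated eigenvalues / `C¹` centre-stable manifolds / finitely many
bombs; TopModeGap risk and "no homoclinic return near `c = 0`" live here); `EjectedMembersSettle 𝒟 d` (FATE, open:
small non-zero members recaptured by NO gravitational bomb of `d` settle, d.o.c. sense, to mode-stable regular holes;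
`SlowlyRotatingKerrFrontier` declared). `stub_dualModeEjection_of_residuals` (registered helper): their universal
closures imply `Sig4.stub_dualModeEjection`, each consumed — transport gives the detectors and, from `det ≠ 0` (a
non-zero COLUMN per selected detector) and annihilation, the transversality hypothesis of the saddle
(`saddleTransversal_of_dualModeTransport`); the saddle gives curve and non-recapture; the fate gives settling; radii
merged by `min`. None restates the stub. No named fact, no axiom, no `sorry`; the stub stays open
(`stub-blocked: EjectedMembersSettle`).
-/

-- every `Summit.FinalStateConjecture.FinalStateConjecture.…` name repeats the summit = sub-problem segment (D-0017 layout)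
set_option linter.dupNamespace false
set_option maxSynthPendingDepth 3

noncomputable section

open scoped Manifold ContDiff Topology BigOperators
open Set Filter Bundle MeasureTheory Literature.Geometry.Lorentzian

namespace Summit.FinalStateConjecture.FinalStateConjecture.Theorems.SymplecticDualOfTheBomb

open Summit.FinalStateConjecture.FinalStateConjecture.Theorems.OneLockedExplosion

/-! ## §1 Audit certificates: locally vanishing pairs are gauge; the pairing only reads the kick's support -/

section Audit

variable {X : Type} [TopologicalSpace X] [ChartedSpace E3 X] [IsManifold (𝓡 3) ∞ X]

/-- **A pair `(A, B)` vanishing on a neighbourhood of `x₀` IS a local slice tangent at `x₀`** (witness: the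
open set on which both vanish, the constant deformation `ι_s := ι` with the development's own future unit
normals — both first variations vanish there). Hence "detectors supported away from `x₀`" are excluded by the
non-gauge clause of `AreDetectorsAt`: audit item (i). [folklore] -/
theorem isLocalSliceTangentAt_of_eventuallyEq_zero : ∀ (X : Type) [TopologicalSpace X] [ChartedSpace E3 X] [IsManifold (𝓡 3) ∞ X] [T2Space X] [SecondCountableTopology X] [ConnectedSpace X] (D : InitialDataSet (𝓡 3) X) (𝒟 : VacuumCauchyDevelopment D) (A B : BilinField X) (x₀ : X), (∀ᶠ x in 𝓝 x₀, A x = 0) → (∀ᶠ x in 𝓝 x₀, B x = 0) → IsLocalSliceTangentAt 𝒟 A B x₀ := by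
  intro X _ _ _ _ _ _ D 𝒟 A B x₀ hA hB
  obtain ⟨V, hVsub, hVopen, hxV⟩ := mem_nhds_iff.1 (hA.and hB)
  refine ⟨V, 1, hVopen, hxV, one_pos, fun _ ↦ 𝒟.embed, fun _ ↦ 𝒟.normal, rfl, ?_, ?_, ?_⟩
  · exact (𝒟.isSmoothEmbedding.contMDiff.comp contMDiff_snd).contMDiffOn
  · intro s _ y _
    exact ⟨fun v ↦ 𝒟.isFutureUnitNormal.1.1 y v, 𝒟.isFutureUnitNormal.1.2 y,
      𝒟.isFutureUnitNormal.2 y⟩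
  · intro y hy v w
    have hy' : A y = 0 ∧ B y = 0 := hVsub hy
    rw [hy'.1, hy'.2]
    exact ⟨hasDerivAt_const _ _, hasDerivAt_const _ _⟩

/-- **A family of detectors none of whose members may vanish near `x₀`**: if some `(Aⱼ, Bⱼ)` vanishes on a
neighbourhood of `x₀`, the combination with coefficient vector `e_j` is a local slice tangent at `x₀`
(`isLocalSliceTangentAt_of_eventuallyEq_zero`), so `AreDetectorsAt` fails. [folklore] -/
theorem not_areDetectorsAt_of_eventuallyEq_zero : ∀ (X : Type) [TopologicalSpace X] [ChartedSpace E3 X] [IsManifold (𝓡 3) ∞ X] [T2Space X] [SecondCountableTopology X] [ConnectedSpace X] (D : InitialDataSet (𝓡 3) X) (𝒟 : VacuumCauchyDevelopment D) (x₀ : X) (k : ℕ) (A B : Fin k → BilinField X), (∃ j, (∀ᶠ x in 𝓝 x₀, A j x = 0) ∧ ∀ᶠ x in 𝓝 x₀, B j x = 0) → ¬ AreDetectorsAt 𝒟 x₀ A B := by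
  intro X _ _ _ _ _ _ D 𝒟 x₀ k A B ⟨j, hA, hB⟩ hdet
  have ha : (Pi.single j (1 : ℝ) : Fin k → ℝ) ≠ 0 := by
    intro h
    have h1 := congrFun h j
    simp at h1
  refine hdet.2.2 (Pi.single j 1) ha (isLocalSliceTangentAt_of_eventuallyEq_zero X D 𝒟 _ _ x₀ ?_ ?_)
  · filter_upwards [hA] with x hx
    simp only [Pi.single_apply, ite_smul, one_smul, zero_smul, Finset.sum_ite_eq', Finset.mem_univ,
      if_true, hx]
  · filter_upwards [hB] with x hx
    simp only [Pi.single_apply, ite_smul, one_smul, zero_smul, Finset.sum_ite_eq', Finset.mem_univ,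
      if_true, hx]

/-- **The symplectic density vanishes where the kick vanishes** (it is linear in `(a, b)`). [folklore] -/
theorem omegaDensity_eq_zero_of_kick_eq_zero : ∀ (X : Type) [TopologicalSpace X] [ChartedSpace E3 X] [IsManifold (𝓡 3) ∞ X] (D : InitialDataSet (𝓡 3) X) (A B a b : BilinField X) (x : X), a x = 0 → b x = 0 → omegaDensity D A B a b x = 0 := by
  intro X _ _ _ D A B a b x ha hb
  have h1 : ∀ T : TangentSpace (𝓡 3) x →L[ℝ] TangentSpace (𝓡 3) x →L[ℝ] ℝ, symInner D x 0 T = 0 :=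
    fun T ↦ by simpa using symInner_smul_left D x 0 0 T
  have h2 : ∀ S : TangentSpace (𝓡 3) x →L[ℝ] TangentSpace (𝓡 3) x →L[ℝ] ℝ, symInner D x S 0 = 0 :=
    fun S ↦ by simpa using symInner_smul_right D x 0 S 0
  have h3 : hTrace D x 0 = 0 := by simpa using hTrace_smul D x 0 0
  simp only [omegaDensity, ha, hb, h1, h2, h3]
  ring

/-- **The chart pairing only reads the detectors on the support of the kick**: two detector pairs which agree
wherever `(a, b) ≠ (0, 0)` have the same pairing with `(a, b)` (pointwise equality of the integrands; no
integrability is needed). So junk values of the detectors off the support of an admissible compactly supported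
family are invisible to the pairing matrix: audit item (i). [folklore] -/
theorem chartPairing_congr_on_kick_support : ∀ (X : Type) [TopologicalSpace X] [ChartedSpace E3 X] [IsManifold (𝓡 3) ∞ X] (D : InitialDataSet (𝓡 3) X) (x₀ : X) (A B A' B' a b : BilinField X), (∀ x, (a x ≠ 0 ∨ b x ≠ 0) → A x = A' x ∧ B x = B' x) → chartPairing D x₀ A B a b = chartPairing D x₀ A' B' a b := by
  intro X _ _ _ D x₀ A B A' B' a b h
  unfold chartPairing
  congr 1
  funext y
  congr 1
  by_cases hab : a ((extChartAt (𝓡 3) x₀).symm y) = 0 ∧ b ((extChartAt (𝓡 3) x₀).symm y) = 0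
  · rw [omegaDensity_eq_zero_of_kick_eq_zero X D A B a b _ hab.1 hab.2,
      omegaDensity_eq_zero_of_kick_eq_zero X D A' B' a b _ hab.1 hab.2]
  · obtain ⟨hA, hB⟩ := h _ (not_and_or.1 hab)
    simp only [omegaDensity, hA, hB]

end Audit

/-! ## §2 The two data-level interfaces of the decomposition: recapture by a hole, recaptured tangents -/

section Interfaces

variable {𝓢 : Spacetime.{0} 4} {O : Set 𝓢.carrier} {k : ℕ}

/-- **Hole `j` of the decomposition `d` is a GRAVITATIONAL BOMB**: it carries a growing gravitational
Killing-mode pair read in its adapted chart (`IsGravitationalModePair`, rate `ν > 0`) — the shape of the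
hypothesis of `Sig4.stub_dualModeEjection` on the hole `i`. [folklore] -/
def IsGravitationalBomb (d : StationaryFinalStateDecomposition 𝓢 O k) (j : Fin d.N) : Prop :=
  ∃ (ν ϖ : ℝ) (h₁ h₂ : HoleBilinField (d.hole j)), 0 < ν ∧
    IsGravitationalModePair (d.hole j) (d.adapted j) ν ϖ h₁ h₂

end Interfaces

section Data

variable {X : Type} [TopologicalSpace X] [ChartedSpace E3 X] [IsManifold (𝓡 3) ∞ X]

/-- **The datum `D'` is (re)captured by the stationary hole `𝓑`**: SOME maximal vacuum Cauchy development of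
`D'` settles regularly — in the r4 sense of `SettlesDocWith'`: honest exterior `O' = exteriorOf 𝒟' d'.charted`,
`HasExhaustiveDocCharts'`, `IsHorizonNormalised`, collar / asymptotically Cartesian / asymptotically
Schwarzschildean charts, telescope, `I⁺`-regular holes — onto a stationary configuration `d'` one of whose holes
IS `𝓑` (an isometric copy can always be replaced by `𝓑` itself in a decomposition, so hole equality is the honest
"same stationary spacetime"): the data-level basin of `𝓑`, interface of the three residuals below. [folklore] -/
def IsRecapturedBy (X : Type) [TopologicalSpace X] [ChartedSpace E3 X] [IsManifold (𝓡 3) ∞ X] [T2Space X]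
    [SecondCountableTopology X] [ConnectedSpace X] (D' : InitialDataSet (𝓡 3) X)
    (𝓑 : StationaryAFBlackHole.{0}) : Prop :=
  ∃ 𝒟' : VacuumCauchyDevelopment D', 𝒟'.IsMaximal ∧
    ∃ (O' : Set 𝒟'.carrier) (d' : StationaryFinalStateDecomposition 𝒟'.toSpacetime O' 2),
      O' = Summit.FinalStateConjecture.exteriorOf 𝒟'.toCauchyDevelopment d'.charted ∧
        HasExhaustiveDocCharts' d' ∧ IsHorizonNormalised d' ∧
          (∀ i, (d'.hole i).horizon ⊆ Set.range (d'.adapted i).toFun ∧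
            ChartIsAsymptoticallyCartesian (d'.adapted i) ∧
              ChartIsAsymptoticallySchwarzschildean' (d'.adapted i) ∧
                InTelescope (d'.hole i) ∧ (d'.hole i).IsIPlusRegular) ∧
          ∃ i', d'.hole i' = 𝓑

/-- The tangents of a constant family vanish (both parts: derivatives of constant fibre curves). [folklore] -/
private theorem famTangent_const' {m : ℕ} (D : InitialDataSet (𝓡 3) X) (j : Fin m) :
    famTangentH (fun _ : EuclideanSpace ℝ (Fin m) ↦ D) j = 0 ∧ famTangentK (fun _ : EuclideanSpace ℝ (Fin m) ↦ D) j = 0 :=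
  ⟨funext fun x ↦ deriv_const (0 : ℝ) (show E3 →L[ℝ] E3 →L[ℝ] ℝ from D.h.inner x),
    funext fun x ↦ deriv_const (0 : ℝ) (show E3 →L[ℝ] E3 →L[ℝ] ℝ from D.k x)⟩

variable [T2Space X] [SecondCountableTopology X] [ConnectedSpace X]

/-- **`(a, b)` is a recaptured-by-`𝓑` tangent at `D` (read at `x₀`)**: it is the first-order tangent at `0` of
a jointly smooth admissible one-parameter family through `D`, supported in a compact subset of the chart source at
`x₀`, all of whose members with small parameter are recaptured by `𝓑` — the data-level tangent space at `D` of the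
(centre-)stable set of `𝓑` inside the compactly supported admissible deformations. [folklore] -/
def IsRecapturedTangentAt (x₀ : X) (D : InitialDataSet (𝓡 3) X) (𝓑 : StationaryAFBlackHole.{0})
    (a b : BilinField X) : Prop :=
  ∃ (δ : ℝ) (F₁ : EuclideanSpace ℝ (Fin 1) → InitialDataSet (𝓡 3) X), 0 < δ ∧
    InitialDataSet.IsSmoothDataFamily 1 F₁ ∧ F₁ 0 = D ∧ (∀ s, F₁ s ∈ admissibleVacuumData X) ∧
    (∃ K : Set X, IsCompact K ∧ K ⊆ (extChartAt (𝓡 3) x₀).source ∧ IsSupportedIn D F₁ K) ∧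
    (∀ s : EuclideanSpace ℝ (Fin 1), |s 0| < δ → IsRecapturedBy X (F₁ s) 𝓑) ∧
    famTangentH F₁ 0 = a ∧ famTangentK F₁ 0 = b

/-- **Under the hypotheses of the stub, `D` is recaptured by every hole of `d`** (witness: `𝒟`, `O`, `d`
themselves). In particular the non-recapture conclusion of the saddle below is not of a vacuous shape: the centre
`F 0 = D` of the curve IS recaptured. [folklore] -/
theorem isRecapturedBy_hole {D : InitialDataSet (𝓡 3) X} (𝒟 : VacuumCauchyDevelopment D) (h𝒟 : 𝒟.IsMaximal)
    {O : Set 𝒟.carrier} (d : StationaryFinalStateDecomposition 𝒟.toSpacetime O 2)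
    (hO : O = Summit.FinalStateConjecture.exteriorOf 𝒟.toCauchyDevelopment d.charted)
    (hex : HasExhaustiveDocCharts' d) (hnorm : IsHorizonNormalised d)
    (hreg : ∀ i, (d.hole i).horizon ⊆ Set.range (d.adapted i).toFun ∧
      ChartIsAsymptoticallyCartesian (d.adapted i) ∧ ChartIsAsymptoticallySchwarzschildean' (d.adapted i) ∧
        InTelescope (d.hole i) ∧ (d.hole i).IsIPlusRegular) (j : Fin d.N) :
    IsRecapturedBy X D (d.hole j) :=
  ⟨𝒟, h𝒟, O, d, hO, hex, hnorm, hreg, j, rfl⟩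

/-- **The zero pair is a recaptured tangent at every recaptured admissible datum** (witness: the constant
family, supported in `K = ∅`). Typing certificate of `IsRecapturedTangentAt`, and the reason `k = 0` detectors are
structurally excluded from the saddle (`not_saddleTransversal_fin_zero`). [folklore] -/
theorem isRecapturedTangentAt_zero : ∀ (X : Type) [TopologicalSpace X] [ChartedSpace E3 X] [IsManifold (𝓡 3) ∞ X] [T2Space X] [SecondCountableTopology X] [ConnectedSpace X] (x₀ : X), ∀ D ∈ admissibleVacuumData X, ∀ (𝓑 : StationaryAFBlackHole.{0}), IsRecapturedBy X D 𝓑 → IsRecapturedTangentAt x₀ D 𝓑 0 0 :=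
  fun _ _ _ _ _ _ _ _ D hD _ h ↦
    ⟨1, fun _ ↦ D, one_pos, InitialDataSet.isSmoothDataFamily_const 1 D, rfl, fun _ ↦ hD,
      ⟨∅, isCompact_empty, Set.empty_subset _, fun _ _ _ ↦ ⟨rfl, rfl⟩⟩, fun _ _ ↦ h,
      (famTangent_const' D 0).1, (famTangent_const' D 0).2⟩

/-- **`k = 0` is structurally excluded**: with no parameter the only tangent combination is the zero pair,
which IS recaptured (`isRecapturedTangentAt_zero`), so the transversality hypothesis of `BombSaddle` below is
unsatisfiable for a `0`-parameter family at a recaptured admissible datum (consistent with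
`not_injOn_ball_of_forall_mem_range_fin0`, p104819: no curve inside a single datum is injective). [folklore] -/
theorem not_saddleTransversal_fin_zero : ∀ (X : Type) [TopologicalSpace X] [ChartedSpace E3 X] [IsManifold (𝓡 3) ∞ X] [T2Space X] [SecondCountableTopology X] [ConnectedSpace X] (x₀ : X), ∀ D ∈ admissibleVacuumData X, ∀ (𝓑 : StationaryAFBlackHole.{0}), IsRecapturedBy X D 𝓑 → ∀ G : EuclideanSpace ℝ (Fin 0) → InitialDataSet (𝓡 3) X, ¬ ∃ a : Fin 0 → ℝ, ¬ IsRecapturedTangentAt x₀ D 𝓑 (fun x ↦ ∑ j, a j • famTangentH G j x) (fun x ↦ ∑ j, a j • famTangentK G j x) := by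
  rintro X _ _ _ _ _ _ x₀ D hD 𝓑 h G ⟨a, ha⟩
  apply ha
  have hH : (fun x ↦ ∑ j, a j • famTangentH G j x) = (0 : BilinField X) := by
    funext x
    simp
  have hK : (fun x ↦ ∑ j, a j • famTangentK G j x) = (0 : BilinField X) := by
    funext x
    simp
  rw [hH, hK]
  exact isRecapturedTangentAt_zero X x₀ D hD 𝓑 h

end Data

/-! ## §3 The three residuals of `stub_dualModeEjection`, as precise `Prop`s (the line's conjectural objects;
nothing is asserted) -/

section Residuals

variable {X : Type} [TopologicalSpace X] [ChartedSpace E3 X] [IsManifold (𝓡 3) ∞ X]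
  [T2Space X] [SecondCountableTopology X] [ConnectedSpace X] {D : InitialDataSet (𝓡 3) X}

/-- **Residual (T) · dual-mode transport.** `(Aₗ, Bₗ)ₗ` are DUAL-MODE DETECTORS for the configuration `d` at
`x₀`: (1) symmetric detectors at the germ-KID-free point `x₀` (`AreSymmDetectorsAt`: no non-trivial combination is
locally pure gauge at `x₀` — local non-gauge-ness of the dual modes at SOME KID-free point is part of the debt);
(2) globally smooth on the slice (the dual modes are global fields; this makes every pairing below an honest
integral); (3) for every gravitational bomb `j` of `d` a selected detector `sel j` whose pairing functional
— `(a, b) ↦ ω_{Σ₀}((A_{sel j}, B_{sel j}), (a, b))` read in the chart at `x₀`, extended by linearity to real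
combinations of tangents of an arbitrary admissible compactly supported family `G'` — ANNIHILATES every
recaptured-by-`𝓑ⱼ` tangent (`IsRecapturedTangentAt`). Mechanism (absent from tree and print as a theorem): the
Σ₀-data of the backward (co-resonant, rate `−ν`) dual of a growing mode of `𝓑ⱼ`, transported to the initial slice
through `𝒟` by the conserved symplectic current of linearised gravity (Cauchy slices, no flux lost), represent the
coefficient of that growing mode at late times; tangents of recaptured curves lie in the tangent space of the
centre-stable manifold of `𝓑ⱼ`, on which every unstable coefficient vanishes. The registered stub's first conjunct
is (1). (ref: Wald1984GR, Appendix E.2; DafermosLuk2017, §1.2.1) [folklore] -/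
def DualModeTransport (𝒟 : VacuumCauchyDevelopment D) {O : Set 𝒟.carrier}
    (d : StationaryFinalStateDecomposition 𝒟.toSpacetime O 2) (x₀ : X) {k : ℕ}
    (A B : Fin k → BilinField X) : Prop :=
  AreSymmDetectorsAt 𝒟 x₀ A B ∧
  (∀ l, SmoothBilinOn (A l) Set.univ ∧ SmoothBilinOn (B l) Set.univ) ∧
  ∃ sel : Fin d.N → Fin k, ∀ j, IsGravitationalBomb d j →
    ∀ (k' : ℕ) (G' : EuclideanSpace ℝ (Fin k') → InitialDataSet (𝓡 3) X) (a : Fin k' → ℝ),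
      InitialDataSet.IsSmoothDataFamily k' G' → G' 0 = D → (∀ c, G' c ∈ admissibleVacuumData X) →
      (∃ K' : Set X, IsCompact K' ∧ K' ⊆ (extChartAt (𝓡 3) x₀).source ∧ IsSupportedIn D G' K') →
      IsRecapturedTangentAt x₀ D (d.hole j) (fun x ↦ ∑ j', a j' • famTangentH G' j' x)
        (fun x ↦ ∑ j', a j' • famTangentK G' j' x) →
      ∑ j', a j' * chartPairing D x₀ (A (sel j)) (B (sel j)) (famTangentH G' j') (famTangentK G' j') = 0

/-- **Residual (S) · the bomb saddle, stated on data.** At a germ-KID-free `x₀` (so that compactly supported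
admissible deformations near `x₀` form a manifold through `D`) and a datum `D` recaptured by every gravitational
bomb of `d`: every jointly smooth admissible `k`-family `G` through `D`, supported in a compact subset of the chart
source at `x₀`, which for EVERY gravitational bomb `j` of `d` has SOME real combination of its tangents that is not
a recaptured-by-`𝓑ⱼ` tangent, and with at least one gravitational bomb present, contains a jointly smooth, locally
injective curve `F` through `D` (`F c = G c'`) none of whose members `0 < |c₀| < ε` is recaptured by ANY
gravitational bomb of `d`. Mechanism (absent): each growing mode is an isolated finite-multiplicity eigenvalue of
the regular-slicing generator, each bomb has a `C¹` centre-stable manifold of the expected codimension inside the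
deformation manifold (finite-codimension stability template of DHRT), the bad directions form finitely many proper
linear subspaces of `ℝᵏ`, so a generic line of `G` leaves every bomb to first order and hence is off every
centre-stable manifold for small `c ≠ 0`; "no return to the same bomb for `c → 0`" is included. `k = 0` is
excluded by the hypotheses (`not_saddleTransversal_fin_zero`). (ref: arXiv210408222, §1; DafermosLuk2017, §1.2.1)
[folklore] -/
def BombSaddle (𝒟 : VacuumCauchyDevelopment D) {O : Set 𝒟.carrier}
    (d : StationaryFinalStateDecomposition 𝒟.toSpacetime O 2) (x₀ : X) : Prop :=
  IsKIDFreeAt 𝒟 x₀ → (∀ j, IsGravitationalBomb d j → IsRecapturedBy X D (d.hole j)) →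
    ∀ (k : ℕ) (G : EuclideanSpace ℝ (Fin k) → InitialDataSet (𝓡 3) X),
      InitialDataSet.IsSmoothDataFamily k G → G 0 = D → (∀ c, G c ∈ admissibleVacuumData X) →
      (∃ K : Set X, IsCompact K ∧ K ⊆ (extChartAt (𝓡 3) x₀).source ∧ IsSupportedIn D G K) →
      (∀ j, IsGravitationalBomb d j → ∃ a : Fin k → ℝ,
        ¬ IsRecapturedTangentAt x₀ D (d.hole j) (fun x ↦ ∑ j', a j' • famTangentH G j' x)
          (fun x ↦ ∑ j', a j' • famTangentK G j' x)) →
      (∃ j, IsGravitationalBomb d j) →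
      ∃ (ε : ℝ) (F : EuclideanSpace ℝ (Fin 1) → InitialDataSet (𝓡 3) X), 0 < ε ∧
        InitialDataSet.IsSmoothDataFamily 1 F ∧ F 0 = D ∧ (∀ c, ∃ c', F c = G c') ∧
        (∀ c c' : EuclideanSpace ℝ (Fin 1), |c 0| < ε → |c' 0| < ε → F c = F c' → c = c') ∧
        ∀ c : EuclideanSpace ℝ (Fin 1), c ≠ 0 → |c 0| < ε →
          ∀ j, IsGravitationalBomb d j → ¬ IsRecapturedBy X (F c) (d.hole j)

/-- **Residual (F) · the ejected members settle (the FATE; open problem).** For a datum `D` whose maximal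
development `𝒟` has complete `𝓘⁺` and settles regularly (r4 clauses) to the configuration `d` with at least one
gravitational bomb: along every jointly smooth admissible curve `F` through `D` of compactly supported
modifications whose members `0 < |c₀| < ε` are recaptured by NO gravitational bomb of `d`, the members
`0 < |c₀| < ε'` (some `ε' > 0`) settle, in the d.o.c. sense, to MODE-STABLE regular holes
(`SettlesDocWith' ModeStable`). Content (absent, summit-hard): weak cosmic censorship and large-data settling for
the kicked data, a dynamical third law and `I⁺`-regularity of the limits, capture by Kerr after the excursion
(`SlowlyRotatingKerrFrontier`), and non-capture by bombs foreign to `d` near `c = 0`. (ref: DafermosLuk2017,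
§1.2.1) [folklore] -/
def EjectedMembersSettle (𝒟 : VacuumCauchyDevelopment D) {O : Set 𝒟.carrier}
    (d : StationaryFinalStateDecomposition 𝒟.toSpacetime O 2) : Prop :=
  𝒟.IsMaximal → Summit.FinalStateConjecture.HasCompleteNullInfinity 𝒟.toCauchyDevelopment →
    O = Summit.FinalStateConjecture.exteriorOf 𝒟.toCauchyDevelopment d.charted →
    HasExhaustiveDocCharts' d → IsHorizonNormalised d →
    (∀ i, (d.hole i).horizon ⊆ Set.range (d.adapted i).toFun ∧
      ChartIsAsymptoticallyCartesian (d.adapted i) ∧ ChartIsAsymptoticallySchwarzschildean' (d.adapted i) ∧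
        InTelescope (d.hole i) ∧ (d.hole i).IsIPlusRegular) →
    (∃ j, IsGravitationalBomb d j) →
    ∀ (ε : ℝ) (F : EuclideanSpace ℝ (Fin 1) → InitialDataSet (𝓡 3) X), 0 < ε →
      InitialDataSet.IsSmoothDataFamily 1 F → F 0 = D → (∀ c, F c ∈ admissibleVacuumData X) →
      (∃ K : Set X, IsCompact K ∧ IsSupportedIn D F K) →
      (∀ c : EuclideanSpace ℝ (Fin 1), c ≠ 0 → |c 0| < ε →
        ∀ j, IsGravitationalBomb d j → ¬ IsRecapturedBy X (F c) (d.hole j)) →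
      ∃ ε' : ℝ, 0 < ε' ∧ ∀ c : EuclideanSpace ℝ (Fin 1), c ≠ 0 → |c 0| < ε' →
        SettlesDocWith' ModeStable X (F c)

/-- **Transport + `det ≠ 0` ⇒ the transversality hypothesis of the saddle.** If the detectors are dual-mode
detectors (`DualModeTransport`) and the pairing matrix of a family `G` (of the kind the stub quantifies over) is
non-singular, then for every gravitational bomb `j` of `d` some tangent of `G` is not a recaptured-by-`𝓑ⱼ`
tangent: the column `sel j` of the pairing matrix is non-zero (`Matrix.det_eq_zero_of_column_eq_zero`), say at
row `j'`, and the annihilation clause, read contrapositively on the coefficient vector `e_{j'}`, says that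
`∂_{j'} G|₀` is not recaptured. [folklore] -/
theorem saddleTransversal_of_dualModeTransport (𝒟 : VacuumCauchyDevelopment D) {O : Set 𝒟.carrier}
    (d : StationaryFinalStateDecomposition 𝒟.toSpacetime O 2) (x₀ : X) {k : ℕ} {A B : Fin k → BilinField X}
    (hT : DualModeTransport 𝒟 d x₀ A B) (G : EuclideanSpace ℝ (Fin k) → InitialDataSet (𝓡 3) X)
    (hGs : InitialDataSet.IsSmoothDataFamily k G) (hG0 : G 0 = D) (hGadm : ∀ c, G c ∈ admissibleVacuumData X)
    (hGK : ∃ K : Set X, IsCompact K ∧ K ⊆ (extChartAt (𝓡 3) x₀).source ∧ IsSupportedIn D G K)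
    (hdet : (pairingMatrix D x₀ A B G).det ≠ 0) :
    ∀ j, IsGravitationalBomb d j → ∃ a : Fin k → ℝ,
      ¬ IsRecapturedTangentAt x₀ D (d.hole j) (fun x ↦ ∑ j', a j' • famTangentH G j' x)
        (fun x ↦ ∑ j', a j' • famTangentK G j' x) := by
  obtain ⟨-, -, sel, hann⟩ := hT
  intro j hj
  have hcol : ∃ j', pairingMatrix D x₀ A B G j' (sel j) ≠ 0 := by
    by_contra h
    exact hdet (Matrix.det_eq_zero_of_column_eq_zero (sel j) fun j' ↦ not_not.1 (not_exists.1 h j'))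
  obtain ⟨j', hj'⟩ := hcol
  refine ⟨fun j'' ↦ if j'' = j' then 1 else 0, fun hcap ↦ hj' ?_⟩
  have h := hann j hj k G (fun j'' ↦ if j'' = j' then 1 else 0) hGs hG0 hGadm hGK hcap
  simpa [pairingMatrix, Matrix.of_apply, ite_mul, one_mul, zero_mul, Finset.sum_ite_eq',
    Finset.mem_univ] using h

end Residuals

/-! ## §4 The decomposition: the three residuals imply the registered statement (registered helper) -/

/-- **`stub_dualModeEjection` from its three residuals.** The universal closures of dual-mode transport (T),
the bomb saddle (S) and the fate of the ejected members (F) imply `Sig4.stub_dualModeEjection`: T supplies the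
symmetric detectors at a germ-KID-free `x₀` (the stub's first conjunct); for a family `G` with `det ≠ 0`, T and
`saddleTransversal_of_dualModeTransport` give the transversality hypothesis of S at every gravitational bomb of `d`
(hole `i` is one by hypothesis; `D` is recaptured by every hole of `d`, `isRecapturedBy_hole`); S gives a locally
injective smooth curve `F ⊆ range G` whose small non-zero members are recaptured by no bomb of `d`; F makes them
settle to mode-stable holes; the two radii are merged by `min`. Each residual is consumed, none restates the stub.
[folklore] -/
theorem stub_dualModeEjection_of_residuals : (∀ (X : Type) [TopologicalSpace X] [ChartedSpace E3 X] [IsManifold (𝓡 3) ∞ X] [T2Space X] [SecondCountableTopology X] [ConnectedSpace X], ∀ D ∈ admissibleVacuumData X, ∀ (𝒟 : VacuumCauchyDevelopment D), 𝒟.IsMaximal → Summit.FinalStateConjecture.HasCompleteNullInfinity 𝒟.toCauchyDevelopment → ∀ (O : Set 𝒟.carrier) (d : StationaryFinalStateDecomposition 𝒟.toSpacetime O 2), O = Summit.FinalStateConjecture.exteriorOf 𝒟.toCauchyDevelopment d.charted → HasExhaustiveDocCharts' d → IsHorizonNormalised d → (∀ i, (d.hole i).horizon ⊆ Set.range (d.adapted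 i).toFun ∧ ChartIsAsymptoticallyCartesian (d.adapted i) ∧ ChartIsAsymptoticallySchwarzschildean' (d.adapted i) ∧ InTelescope (d.hole i) ∧ (d.hole i).IsIPlusRegular) → ∀ (i : Fin d.N) (ν ϖ : ℝ) (h₁ h₂ : HoleBilinField (d.hole i)), 0 < ν → IsGravitationalModePair (d.hole i) (d.adapted i) ν ϖ h₁ h₂ → (∃ x : X, IsKIDFreeAt 𝒟 x) → ∃ (x₀ : X) (k : ℕ) (A B : Fin k → BilinField X), DualModeTransport 𝒟 d x₀ A B) → (∀ (X : Type) [TopologicalSpace X] [ChartedSpace E3 X] [IsManifold (𝓡 3) ∞ X] [T2Space X] [SecondCountableTopology X] [ConnectedSpace X] (D : InitialDataSet (𝓡 3) X) (𝒟 : VacuumCauchyDevelopment D) (O : Set 𝒟.carrier) (d : StationaryFinalStateDecomposition 𝒟.toSpacetime O 2) (x₀ : X), BombSaddle 𝒟 d x₀) → (∀ (X : Type) [TopologicalSpace X] [ChartedSpace E3 X] [IsManifold (𝓡 3) ∞ X] [T2Space X] [SecondCountableTopology X] [ConnectedSpace X] (D : InitialDataSet (𝓡 3) X) (𝒟 :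 VacuumCauchyDevelopment D) (O : Set 𝒟.carrier) (d : StationaryFinalStateDecomposition 𝒟.toSpacetime O 2), EjectedMembersSettle 𝒟 d) → Sig4.stub_dualModeEjection := by
  intro hTra hSad hFate X _ _ _ _ _ _ D hD 𝒟 h𝒟 hcni O d hO hex hnorm hreg i ν ϖ h₁ h₂ hν hmode hKID
  obtain ⟨x₀, k, A, B, hTr⟩ := hTra X D hD 𝒟 h𝒟 hcni O d hO hex hnorm hreg i ν ϖ h₁ h₂ hν hmode hKID
  refine ⟨x₀, k, A, B, hTr.1, fun G hGs hG0 hGadm hGK hdet ↦ ?_⟩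
  have hbomb : IsGravitationalBomb d i := ⟨ν, ϖ, h₁, h₂, hν, hmode⟩
  have hrec : ∀ j, IsGravitationalBomb d j → IsRecapturedBy X D (d.hole j) := fun j _ ↦
    isRecapturedBy_hole 𝒟 h𝒟 d hO hex hnorm hreg j
  -- (S): the curve, leaving every bomb of `d`
  obtain ⟨ε, F, hε, hF, hF0, hFG, hinj, hleave⟩ := hSad X D 𝒟 O d x₀ hTr.1.2.1 hrec k G hGs hG0 hGadm hGK
    (saddleTransversal_of_dualModeTransport 𝒟 d x₀ hTr G hGs hG0 hGadm hGK hdet) ⟨i, hbomb⟩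
  have hFadm : ∀ c, F c ∈ admissibleVacuumData X := fun c ↦ by
    obtain ⟨c', hc'⟩ := hFG c
    rw [hc']
    exact hGadm c'
  have hFK : ∃ K : Set X, IsCompact K ∧ IsSupportedIn D F K := by
    obtain ⟨K, hKc, -, hsupp⟩ := hGK
    refine ⟨K, hKc, fun c x hx ↦ ?_⟩
    obtain ⟨c', hc'⟩ := hFG c
    rw [hc']
    exact hsupp c' x hx
  -- (F): the fate of the ejected members
  obtain ⟨ε', hε', hgood⟩ :=
    hFate X D 𝒟 O d h𝒟 hcni hO hex hnorm hreg ⟨i, hbomb⟩ ε F hε hF hF0 hFadm hFK hleave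
  refine ⟨min ε ε', F, lt_min hε hε', hF, hF0, hFG, fun c c' hc hc' h ↦
    hinj c c' (lt_of_lt_of_le hc (min_le_left _ _)) (lt_of_lt_of_le hc' (min_le_left _ _)) h,
    fun c hc hcε ↦ hgood c hc (lt_of_lt_of_le hcε (min_le_right _ _))⟩

end Summit.FinalStateConjecture.FinalStateConjecture.Theorems.SymplecticDualOfTheBomb

end
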